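import Literature.NumberTheory.LFunctions.Zhang2022.Section10Lemma102Tent
import Literature.NumberTheory.LFunctions.Zhang2022.SkeletonReductions
import HarnessLib

/-!
# Zhang (2022), Lemma 10.2 — the steps u019/u021/u022 and the clauses (10.8)–(10.10), in RELATIVE
# form, from the shift-0 log-mean estimate (Lemma 8.4 at `β_μ = 0`)

Topic `Literature/NumberTheory/LFunctions/Zhang2022` (Landau–Siegel audit tree; verdict-neutral).
Y. Zhang, *Discrete mean estimates and the Landau–Siegel zero*, arXiv:2211.02515v1 (2022)
[Zhang2022LandauSiegel] — **an unrefereed manuscript under adjudication; nothing in this file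
asserts any claim of the manuscript.** Cell siegel-zhang (D-0069), F6 (L3 LEDGER #12 (3) / #14 (4)),
DAG nodes `Z22:§10.u019` [Z22 p.56, tex L2831], `Z22:§10.u021` [tex L2842], `Z22:§10.u022`
[tex L2847], `Z22:(10.8)–(10.10)` [Z22 p.55, tex L2794–L2810]; gap row G-d43-1 (pre-assigned).

THE REDUCTION (kernel-checked here). Write `A_{d,r}(x) = Σ_{n≤x} χ(n)ξ₀ⱼ(n;d,r)n⁻¹log(x/n)` and
`R(d,r) = (∏_{q∣dr}(1 − q⁻¹)⁻¹)²`. The hypothesis `hA` of each theorem below is **Lemma 8.4 at shift `β_μ = 0`** in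
the relative form the printed contour argument delivers (cf. `Skeleton.Lemma84Rel`, G-d55-3/G-adj1-1):
for `dr < PT⁻²`, `T ≤ x ≤ P`,
`‖A_{d,r}(x) − L′(1,χ)Π(d,r)(1 + (β_{j+1}+β_{j+2})log x + ½β_{j+1}β_{j+2}log²x)‖ ≤ C𝓛⁻⁶R(d,r)`
(its kernel proof = sz-d27's Lemma 8.4 engine `Section8Lemma84{Coeff,LBounds,Contour,Core}` with the
shift-0 pieces `Section10Lemma102Model`/`Section10Lemma102Poles` — STAGED, see HANDOFF sz-d43).
GIVEN `hA`, by the tent decomposition `Section10Lemma102Tent.frakv2_eq_logMeans` and the residue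
combinations `resComb_three/two/one`:

* `eq108Rel_of_logMean` — (10.8) on `dr ≤ P^{0.5}/T` with error `C′𝓛⁻¹⁵R(d,r)`;
* `eq109Rel_of_logMean` — (10.9) on `P^{0.5} < dr ≤ P^{0.502}/T` (the `P^{0.5}`-mean is EMPTY);
* `eq1010Rel_of_logMean` — (10.10) on `P^{0.502} < dr ≤ P^{0.504}/T` (two means empty);
* `step10u019Rel_of_logMean`, `step10u021rRel_of_logMean`, `step10u022Rel_of_logMean` — the same in
  the manuscript's circle-integral form of u019/u021/u022 (radius `10α`; L3-t1's
  `Typed.Sec10A.residue102a/b/c_eq` evaluate the circle integrals), i.e. the typed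
  `Typed.Sec10A.Step10u019 / Step10u021r / Step10u022` VERBATIM except for the factor `R(d,r)`.

Would-be gap G-d43-1 (class printed-slip/relative, family of `Lemma84Rel`): the printed absolute
`O(𝓛⁻¹⁵)` of (10.8)–(10.10) is not what the printed proof delivers; the relative form above is, and
the consumer `Skeleton.Ded1017Rel` (sz-skel) is in the tree. Theorem-only; 0 new definitions (the hypothesis is spelled out in each statement), 0 new
facts. WHAT THIS IS NOT: a proof of `hA`, of Lemma 10.2, or of anything about Theorems 1–2 /
Landau–Siegel zeros.

## References

* Y. Zhang, arXiv:2211.02515v1 (2022), §10 Lemma 10.2 (pp. 55–56), §8 Lemma 8.4.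
  [cite: Zhang2022LandauSiegel, §10 Lemma 10.2]
-/

noncomputable section

open Complex Real

namespace Literature.NumberTheory.LFunctions.Zhang2022.Lemma102

open Literature.NumberTheory.LFunctions.Zhang2022.Skeleton

variable {c' : ℝ}

/-! ### Elementary range bookkeeping -/

/-- `log D ≥ 2` once `D ≥ 8`. [folklore] -/
private theorem two_le_log_of_eight_le {D : ℕ} (hD : 8 ≤ D) : 2 ≤ Real.log D := by
  have h8 : (8 : ℝ) ≤ D := by exact_mod_cast hD
  have h2 : (2 : ℝ) ≤ Real.log 8 := by
    rw [Real.le_log_iff_exp_le (by norm_num)]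
    have h1 := Real.exp_one_lt_d9
    have h0 := Real.exp_pos 1
    have hsq : Real.exp 2 = Real.exp 1 * Real.exp 1 := by rw [← Real.exp_add]; norm_num
    rw [hsq]
    nlinarith
  exact h2.trans (Real.log_le_log (by norm_num) h8)

/-- For `d, r ≥ 1`, `y = dr > 0`. [folklore] -/
private theorem dr_pos {d r : ℕ} (hd : 1 ≤ d) (hr : 1 ≤ r) : (0 : ℝ) < ((d * r : ℕ) : ℝ) := by
  have : 1 ≤ d * r := Nat.one_le_iff_ne_zero.mpr (Nat.mul_ne_zero (by omega) (by omega))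
  exact_mod_cast this

/-- The common range facts: for `log D ≥ 2`, `d,r ≥ 1` and `dr ≤ P^{a}/T` with `a ≤ 0.504`:
`T ≤ P^{a}/dr`, `P^{b}/dr ≤ P` for `b ≤ 1`, and `dr < PT⁻²`. [cite: Zhang2022LandauSiegel, §10 Lemma 10.2] -/
private theorem range_facts {D d r : ℕ} (hD : 2 ≤ Real.log D) (hd : 1 ≤ d) (hr : 1 ≤ r) {a : ℝ}
    (ha : a ≤ 0.504) (hdr : ((d * r : ℕ) : ℝ) ≤ bigP D ^ a / bigT D) :
    bigT D ≤ bigP D ^ a / ((d * r : ℕ) : ℝ) ∧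
      (∀ b : ℝ, b ≤ 1 → bigP D ^ b / ((d * r : ℕ) : ℝ) ≤ bigP D) ∧
      ((d * r : ℕ) : ℝ) < bigP D / bigT D ^ 2 := by
  have hy := dr_pos hd hr
  have hT : 0 < bigT D := Real.exp_pos _
  have hP : 0 < bigP D := Real.exp_pos _
  have hP1 : 1 ≤ bigP D := Real.one_le_exp (pow_nonneg (Real.log_natCast_nonneg D) _)
  have hy1 : (1 : ℝ) ≤ ((d * r : ℕ) : ℝ) := by
    have : 1 ≤ d * r := Nat.one_le_iff_ne_zero.mpr (Nat.mul_ne_zero (by omega) (by omega))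
    exact_mod_cast this
  refine ⟨?_, fun b hb => ?_, ?_⟩
  · rw [le_div_iff₀ hy]
    rw [le_div_iff₀ hT] at hdr
    nlinarith [mul_comm (bigT D) (((d * r : ℕ) : ℝ))]
  · calc bigP D ^ b / ((d * r : ℕ) : ℝ) ≤ bigP D ^ b := div_le_self (by positivity) hy1
      _ ≤ bigP D ^ (1 : ℝ) := Real.rpow_le_rpow_of_exponent_le hP1 hb
      _ = bigP D := Real.rpow_one _
  · have h1 : bigP D ^ a / bigT D ≤ bigP D ^ (0.504 : ℝ) / bigT D := by
      gcongr
    have h2 : bigP D ^ (0.504 : ℝ) / bigT D ≤ bigP D ^ (0.504 : ℝ) := by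
      refine div_le_self (by positivity) ?_
      exact Real.one_le_exp (by positivity)
    have h3 : bigP D ^ (0.504 : ℝ) < bigP D / bigT D ^ 2 := P1_lt_P_div_T_sq D hD
    linarith

/-! ### (10.8)–(10.10) in relative form -/

/-- **(10.8), relative form, from the shift-0 log-mean estimate** [Z22 p.55, (10.8), tex L2794; proof
p.56 tex L2824–L2839]: if `dr ≤ P^{0.5}/T` then
`‖𝔳₂ⱼ(d,r) − (L′(1,χ)Π(d,r)/500)β_{j+1}β_{j+2}log P‖ ≤ C′𝓛⁻¹⁵(∏_{q∣dr}(1−q⁻¹)⁻¹)²`, `C′ = 2000C`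
(the three means at `P^{0.504}/dr, P^{0.502}/dr, P^{0.5}/dr ≥ T`; residues combine to
`β_{j+1}β_{j+2}(log P/500)²`, `resComb_three`). [cite: Zhang2022LandauSiegel, §10 (10.8)] -/
theorem eq108Rel_of_logMean (hA : ∃ C : ℝ, ForAllLarge fun D _ χ => AssumptionA D χ → ∀ j ∈ ({1, 2, 3} : Finset ℕ), ∀ d r : ℕ,
          1 ≤ d → 1 ≤ r → ((d * r : ℕ) : ℝ) < bigP D / bigT D ^ 2 → ∀ x : ℝ, bigT D ≤ x → x ≤ bigP D →
            ‖(∑ n ∈ Finset.Ioc 0 ⌊x⌋₊, χ (n : ZMod D) * xiZero c' D j n d r / (n : ℂ) *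
                  (Real.log (x / n) : ℂ)) -
                deriv χ.LFunction 1 * PiW χ d r *
                  (1 + (betaJ c' D (j + 1) + betaJ c' D (j + 2)) * (Real.log x : ℂ) +
                    betaJ c' D (j + 1) * betaJ c' D (j + 2) * (Real.log x : ℂ) ^ 2 / 2)‖ ≤
              C * (ell D ^ 6)⁻¹ * (∏ q ∈ (d * r).primeFactors, (1 - (q : ℝ)⁻¹)⁻¹) ^ 2) :
    ∃ C : ℝ, ForAllLarge fun D _ χ => AssumptionA D χ →
      ∀ j ∈ ({1, 2, 3} : Finset ℕ), ∀ d r : ℕ, 1 ≤ d → 1 ≤ r →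
        ((d * r : ℕ) : ℝ) ≤ bigP D ^ (0.5 : ℝ) / bigT D →
          ‖frakv2 c' χ j d r - deriv χ.LFunction 1 * PiW χ d r / 500 *
            (betaJ c' D (j + 1) * betaJ c' D (j + 2)) * Real.log (bigP D)‖ ≤
            C * (ell D ^ 15)⁻¹ * (∏ q ∈ (d * r).primeFactors, (1 - (q : ℝ)⁻¹)⁻¹) ^ 2 := by
  obtain ⟨C, D₀, h⟩ := hA
  refine ⟨2000 * max C 0, max D₀ 8, fun D _ χ hD hq hp hA' j hj d r hd hr hdr => ?_⟩
  have hD₀ : D₀ ≤ D := le_trans (le_max_left _ _) hD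
  have hlog : 2 ≤ Real.log D := two_le_log_of_eight_le (le_trans (le_max_right _ _) hD)
  have hℓ : 2 ≤ ell D := hlog
  have hP : 0 < bigP D := Real.exp_pos _
  have hP1 : 1 < bigP D := by
    rw [bigP]; exact Real.one_lt_exp_iff.mpr (by rw [ell] at hℓ ⊢; positivity)
  have hy := dr_pos hd hr
  obtain ⟨hT3, hle, hdrP⟩ := range_facts hlog hd hr (a := 0.5) (by norm_num) hdr
  have key := h D χ hD₀ hq hp hA' j hj d r hd hr hdrP
  rw [frakv2_eq_logMeans χ c' j hd hr hP1]
  -- the three means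
  set y : ℝ := ((d * r : ℕ) : ℝ) with hydef
  have hX1 : bigT D ≤ bigP D ^ (0.504 : ℝ) / y := by
    refine hT3.trans ?_; gcongr; exact hP1.le; norm_num
  have hX2 : bigT D ≤ bigP D ^ (0.502 : ℝ) / y := by
    refine hT3.trans ?_; gcongr; exact hP1.le; norm_num
  have e1 := key _ hX1 (hle _ (by norm_num))
  have e2 := key _ hX2 (hle _ (by norm_num))
  have e3 := key _ hT3 (hle _ (by norm_num))
  -- abbreviations
  set M : ℂ := deriv χ.LFunction 1 * PiW χ d r with hM
  set βa : ℂ := betaJ c' D (j + 1)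
  set βb : ℂ := betaJ c' D (j + 2)
  set R : ℝ := (∏ q ∈ (d * r).primeFactors, (1 - (q : ℝ)⁻¹)⁻¹) ^ 2 with hR
  set A1 := ∑ n ∈ Finset.Ioc 0 ⌊bigP D ^ (0.504 : ℝ) / y⌋₊,
    χ (n : ZMod D) * xiZero c' D j n d r / (n : ℂ) * (Real.log (bigP D ^ (0.504 : ℝ) / y / n) : ℂ)
  set A2 := ∑ n ∈ Finset.Ioc 0 ⌊bigP D ^ (0.502 : ℝ) / y⌋₊,
    χ (n : ZMod D) * xiZero c' D j n d r / (n : ℂ) * (Real.log (bigP D ^ (0.502 : ℝ) / y / n) : ℂ)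
  set A3 := ∑ n ∈ Finset.Ioc 0 ⌊bigP D ^ (0.5 : ℝ) / y⌋₊,
    χ (n : ZMod D) * xiZero c' D j n d r / (n : ℂ) * (Real.log (bigP D ^ (0.5 : ℝ) / y / n) : ℂ)
  set m1 := M * (1 + (βa + βb) * (Real.log (bigP D ^ (0.504 : ℝ) / y) : ℂ) +
    βa * βb * (Real.log (bigP D ^ (0.504 : ℝ) / y) : ℂ) ^ 2 / 2)
  set m2 := M * (1 + (βa + βb) * (Real.log (bigP D ^ (0.502 : ℝ) / y) : ℂ) +
    βa * βb * (Real.log (bigP D ^ (0.502 : ℝ) / y) : ℂ) ^ 2 / 2)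
  set m3 := M * (1 + (βa + βb) * (Real.log (bigP D ^ (0.5 : ℝ) / y) : ℂ) +
    βa * βb * (Real.log (bigP D ^ (0.5 : ℝ) / y) : ℂ) ^ 2 / 2)
  have hcomb : m1 - 2 * m2 + m3 = M * (βa * βb * (((Real.log (bigP D) / 500) ^ 2 : ℝ) : ℂ)) := by
    simp only [m1, m2, m3]
    rw [← resComb_three hP hy βa βb]
    ring
  -- the tent decomposition
  have hΛ : (Real.log (bigP D) : ℂ) ≠ 0 := by
    have : 0 < Real.log (bigP D) := Real.log_pos hP1
    exact_mod_cast this.ne'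
  have hv : ((500 / Real.log (bigP D) : ℝ) : ℂ) * (A1 - 2 * A2 + A3) -
      M / 500 * (βa * βb) * Real.log (bigP D) =
      ((500 / Real.log (bigP D) : ℝ) : ℂ) * ((A1 - m1) - 2 * (A2 - m2) + (A3 - m3)) := by
    have : ((500 / Real.log (bigP D) : ℝ) : ℂ) * ((A1 - m1) - 2 * (A2 - m2) + (A3 - m3)) =
        ((500 / Real.log (bigP D) : ℝ) : ℂ) * (A1 - 2 * A2 + A3) -
          ((500 / Real.log (bigP D) : ℝ) : ℂ) * (m1 - 2 * m2 + m3) := by ring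
    rw [this, hcomb]
    push_cast
    field_simp
  rw [show deriv χ.LFunction 1 * PiW χ d r / 500 * (betaJ c' D (j + 1) * betaJ c' D (j + 2)) *
      (Real.log (bigP D) : ℂ) = M / 500 * (βa * βb) * Real.log (bigP D) by rw [hM], hv]
  -- the bound
  have hC0 : C * (ell D ^ 6)⁻¹ * R ≤ max C 0 * (ell D ^ 6)⁻¹ * R := by
    have : 0 ≤ (ell D ^ 6)⁻¹ * R := by positivity
    nlinarith [le_max_left C 0]
  have hE1 : ‖A1 - m1‖ ≤ max C 0 * (ell D ^ 6)⁻¹ * R := e1.trans hC0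
  have hE2 : ‖A2 - m2‖ ≤ max C 0 * (ell D ^ 6)⁻¹ * R := e2.trans hC0
  have hE3 : ‖A3 - m3‖ ≤ max C 0 * (ell D ^ 6)⁻¹ * R := e3.trans hC0
  have hlogP : Real.log (bigP D) = ell D ^ 9 := by rw [bigP, Real.log_exp]
  have hℓ0 : 0 < ell D := by linarith
  have hpre : ‖((500 / Real.log (bigP D) : ℝ) : ℂ)‖ = 500 / ell D ^ 9 := by
    rw [Complex.norm_real, Real.norm_of_nonneg (by rw [hlogP]; positivity), hlogP]
  calc ‖((500 / Real.log (bigP D) : ℝ) : ℂ) * ((A1 - m1) - 2 * (A2 - m2) + (A3 - m3))‖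
      = 500 / ell D ^ 9 * ‖(A1 - m1) - 2 * (A2 - m2) + (A3 - m3)‖ := by rw [norm_mul, hpre]
    _ ≤ 500 / ell D ^ 9 * (‖A1 - m1‖ + 2 * ‖A2 - m2‖ + ‖A3 - m3‖) := by
        gcongr
        calc ‖(A1 - m1) - 2 * (A2 - m2) + (A3 - m3)‖
            ≤ ‖(A1 - m1) - 2 * (A2 - m2)‖ + ‖A3 - m3‖ := norm_add_le _ _
          _ ≤ ‖A1 - m1‖ + ‖2 * (A2 - m2)‖ + ‖A3 - m3‖ := by gcongr; exact norm_sub_le _ _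
          _ = ‖A1 - m1‖ + 2 * ‖A2 - m2‖ + ‖A3 - m3‖ := by rw [norm_mul, Complex.norm_two]
    _ ≤ 500 / ell D ^ 9 * (4 * (max C 0 * (ell D ^ 6)⁻¹ * R)) := by gcongr; linarith
    _ = 2000 * max C 0 * (ell D ^ 15)⁻¹ * R := by field_simp; ring

/-- **(10.9), relative form, from the shift-0 log-mean estimate** [Z22 p.55, (10.9), tex L2798; proof
p.56 tex L2841–L2851]: if `P^{0.5} < dr ≤ P^{0.502}/T` then
`‖𝔳₂ⱼ(d,r) − (500L′(1,χ)Π(d,r)/log P)(−1 + 𝔶₁ⱼ(dr))‖ ≤ C′𝓛⁻¹⁵(∏_{q∣dr}(1−q⁻¹)⁻¹)²` (the mean at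
`P^{0.5}/dr < 1` is empty; the other two residues combine to `−1 + 𝔶₁ⱼ(dr)`, `resComb_two`).
[cite: Zhang2022LandauSiegel, §10 (10.9)] -/
theorem eq109Rel_of_logMean (hA : ∃ C : ℝ, ForAllLarge fun D _ χ => AssumptionA D χ → ∀ j ∈ ({1, 2, 3} : Finset ℕ), ∀ d r : ℕ,
          1 ≤ d → 1 ≤ r → ((d * r : ℕ) : ℝ) < bigP D / bigT D ^ 2 → ∀ x : ℝ, bigT D ≤ x → x ≤ bigP D →
            ‖(∑ n ∈ Finset.Ioc 0 ⌊x⌋₊, χ (n : ZMod D) * xiZero c' D j n d r / (n : ℂ) *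
                  (Real.log (x / n) : ℂ)) -
                deriv χ.LFunction 1 * PiW χ d r *
                  (1 + (betaJ c' D (j + 1) + betaJ c' D (j + 2)) * (Real.log x : ℂ) +
                    betaJ c' D (j + 1) * betaJ c' D (j + 2) * (Real.log x : ℂ) ^ 2 / 2)‖ ≤
              C * (ell D ^ 6)⁻¹ * (∏ q ∈ (d * r).primeFactors, (1 - (q : ℝ)⁻¹)⁻¹) ^ 2) :
    ∃ C : ℝ, ForAllLarge fun D _ χ => AssumptionA D χ →
      ∀ j ∈ ({1, 2, 3} : Finset ℕ), ∀ d r : ℕ, 1 ≤ d → 1 ≤ r →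
        bigP D ^ (0.5 : ℝ) < ((d * r : ℕ) : ℝ) → ((d * r : ℕ) : ℝ) ≤ bigP D ^ (0.502 : ℝ) / bigT D →
          ‖frakv2 c' χ j d r - 500 * deriv χ.LFunction 1 * PiW χ d r / Real.log (bigP D) *
            (-1 + fraky1 c' D j ((d * r : ℕ) : ℝ))‖ ≤
            C * (ell D ^ 15)⁻¹ * (∏ q ∈ (d * r).primeFactors, (1 - (q : ℝ)⁻¹)⁻¹) ^ 2 := by
  obtain ⟨C, D₀, h⟩ := hA
  refine ⟨1500 * max C 0, max D₀ 8, fun D _ χ hD hq hp hA' j hj d r hd hr hlo hdr => ?_⟩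
  have hD₀ : D₀ ≤ D := le_trans (le_max_left _ _) hD
  have hlog : 2 ≤ Real.log D := two_le_log_of_eight_le (le_trans (le_max_right _ _) hD)
  have hℓ : 2 ≤ ell D := hlog
  have hP : 0 < bigP D := Real.exp_pos _
  have hP1 : 1 < bigP D := by
    rw [bigP]; exact Real.one_lt_exp_iff.mpr (by rw [ell] at hℓ ⊢; positivity)
  have hy := dr_pos hd hr
  obtain ⟨hT2, hle, hdrP⟩ := range_facts hlog hd hr (a := 0.502) (by norm_num) hdr
  have key := h D χ hD₀ hq hp hA' j hj d r hd hr hdrP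
  rw [frakv2_eq_logMeans χ c' j hd hr hP1]
  set y : ℝ := ((d * r : ℕ) : ℝ) with hydef
  have hX1 : bigT D ≤ bigP D ^ (0.504 : ℝ) / y := by
    refine hT2.trans ?_; gcongr; exact hP1.le; norm_num
  have e1 := key _ hX1 (hle _ (by norm_num))
  have e2 := key _ hT2 (hle _ (by norm_num))
  -- the empty mean
  have hX3 : bigP D ^ (0.5 : ℝ) / y < 1 := by rwa [div_lt_one hy]
  have hA3 : ∑ n ∈ Finset.Ioc 0 ⌊bigP D ^ (0.5 : ℝ) / y⌋₊,
      χ (n : ZMod D) * xiZero c' D j n d r / (n : ℂ) *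
        (Real.log (bigP D ^ (0.5 : ℝ) / y / n) : ℂ) = 0 :=
    logMean_eq_zero_of_lt_one _ hX3
  -- abbreviations
  set M : ℂ := deriv χ.LFunction 1 * PiW χ d r with hM
  set βa : ℂ := betaJ c' D (j + 1)
  set βb : ℂ := betaJ c' D (j + 2)
  set R : ℝ := (∏ q ∈ (d * r).primeFactors, (1 - (q : ℝ)⁻¹)⁻¹) ^ 2 with hR
  set A1 := ∑ n ∈ Finset.Ioc 0 ⌊bigP D ^ (0.504 : ℝ) / y⌋₊,
    χ (n : ZMod D) * xiZero c' D j n d r / (n : ℂ) * (Real.log (bigP D ^ (0.504 : ℝ) / y / n) : ℂ)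
  set A2 := ∑ n ∈ Finset.Ioc 0 ⌊bigP D ^ (0.502 : ℝ) / y⌋₊,
    χ (n : ZMod D) * xiZero c' D j n d r / (n : ℂ) * (Real.log (bigP D ^ (0.502 : ℝ) / y / n) : ℂ)
  set m1 := M * (1 + (βa + βb) * (Real.log (bigP D ^ (0.504 : ℝ) / y) : ℂ) +
    βa * βb * (Real.log (bigP D ^ (0.504 : ℝ) / y) : ℂ) ^ 2 / 2)
  set m2 := M * (1 + (βa + βb) * (Real.log (bigP D ^ (0.502 : ℝ) / y) : ℂ) +
    βa * βb * (Real.log (bigP D ^ (0.502 : ℝ) / y) : ℂ) ^ 2 / 2)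
  have hcomb : m1 - 2 * m2 = M * (-1 + fraky1 c' D j y) := by
    simp only [m1, m2]
    rw [← resComb_two c' D j hy]
    ring
  have hΛ : (Real.log (bigP D) : ℂ) ≠ 0 := by
    have : 0 < Real.log (bigP D) := Real.log_pos hP1
    exact_mod_cast this.ne'
  rw [hA3]
  have hv : ((500 / Real.log (bigP D) : ℝ) : ℂ) * (A1 - 2 * A2 + 0) -
      500 * M / Real.log (bigP D) * (-1 + fraky1 c' D j y) =
      ((500 / Real.log (bigP D) : ℝ) : ℂ) * ((A1 - m1) - 2 * (A2 - m2)) := by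
    have : ((500 / Real.log (bigP D) : ℝ) : ℂ) * ((A1 - m1) - 2 * (A2 - m2)) =
        ((500 / Real.log (bigP D) : ℝ) : ℂ) * (A1 - 2 * A2 + 0) -
          ((500 / Real.log (bigP D) : ℝ) : ℂ) * (m1 - 2 * m2) := by ring
    rw [this, hcomb]
    push_cast
    field_simp
  rw [show 500 * deriv χ.LFunction 1 * PiW χ d r / (Real.log (bigP D) : ℂ) *
      (-1 + fraky1 c' D j y) = 500 * M / Real.log (bigP D) * (-1 + fraky1 c' D j y) by
      rw [hM]; ring, hv]
  have hC0 : C * (ell D ^ 6)⁻¹ * R ≤ max C 0 * (ell D ^ 6)⁻¹ * R := by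
    have : 0 ≤ (ell D ^ 6)⁻¹ * R := by positivity
    nlinarith [le_max_left C 0]
  have hE1 : ‖A1 - m1‖ ≤ max C 0 * (ell D ^ 6)⁻¹ * R := e1.trans hC0
  have hE2 : ‖A2 - m2‖ ≤ max C 0 * (ell D ^ 6)⁻¹ * R := e2.trans hC0
  have hlogP : Real.log (bigP D) = ell D ^ 9 := by rw [bigP, Real.log_exp]
  have hℓ0 : 0 < ell D := by linarith
  have hpre : ‖((500 / Real.log (bigP D) : ℝ) : ℂ)‖ = 500 / ell D ^ 9 := by
    rw [Complex.norm_real, Real.norm_of_nonneg (by rw [hlogP]; positivity), hlogP]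
  calc ‖((500 / Real.log (bigP D) : ℝ) : ℂ) * ((A1 - m1) - 2 * (A2 - m2))‖
      = 500 / ell D ^ 9 * ‖(A1 - m1) - 2 * (A2 - m2)‖ := by rw [norm_mul, hpre]
    _ ≤ 500 / ell D ^ 9 * (‖A1 - m1‖ + 2 * ‖A2 - m2‖) := by
        gcongr
        calc ‖(A1 - m1) - 2 * (A2 - m2)‖ ≤ ‖A1 - m1‖ + ‖2 * (A2 - m2)‖ := norm_sub_le _ _
          _ = ‖A1 - m1‖ + 2 * ‖A2 - m2‖ := by rw [norm_mul, Complex.norm_two]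
    _ ≤ 500 / ell D ^ 9 * (3 * (max C 0 * (ell D ^ 6)⁻¹ * R)) := by gcongr; linarith
    _ = 1500 * max C 0 * (ell D ^ 15)⁻¹ * R := by field_simp; ring

/-- **(10.10), relative form, from the shift-0 log-mean estimate** [Z22 p.55, (10.10), tex L2806;
proof p.56 tex L2846–L2851]: if `P^{0.502} < dr ≤ P^{0.504}/T` then
`‖𝔳₂ⱼ(d,r) − (500L′(1,χ)Π(d,r)/log P)(1 + 𝔶₂ⱼ(dr))‖ ≤ C′𝓛⁻¹⁵(∏_{q∣dr}(1−q⁻¹)⁻¹)²` (the two means at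
`P^{0.5}/dr, P^{0.502}/dr < 1` are empty; the remaining residue is `1 + 𝔶₂ⱼ(dr)`, `resComb_one`).
[cite: Zhang2022LandauSiegel, §10 (10.10)] -/
theorem eq1010Rel_of_logMean (hA : ∃ C : ℝ, ForAllLarge fun D _ χ => AssumptionA D χ → ∀ j ∈ ({1, 2, 3} : Finset ℕ), ∀ d r : ℕ,
          1 ≤ d → 1 ≤ r → ((d * r : ℕ) : ℝ) < bigP D / bigT D ^ 2 → ∀ x : ℝ, bigT D ≤ x → x ≤ bigP D →
            ‖(∑ n ∈ Finset.Ioc 0 ⌊x⌋₊, χ (n : ZMod D) * xiZero c' D j n d r / (n : ℂ) *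
                  (Real.log (x / n) : ℂ)) -
                deriv χ.LFunction 1 * PiW χ d r *
                  (1 + (betaJ c' D (j + 1) + betaJ c' D (j + 2)) * (Real.log x : ℂ) +
                    betaJ c' D (j + 1) * betaJ c' D (j + 2) * (Real.log x : ℂ) ^ 2 / 2)‖ ≤
              C * (ell D ^ 6)⁻¹ * (∏ q ∈ (d * r).primeFactors, (1 - (q : ℝ)⁻¹)⁻¹) ^ 2) :
    ∃ C : ℝ, ForAllLarge fun D _ χ => AssumptionA D χ →
      ∀ j ∈ ({1, 2, 3} : Finset ℕ), ∀ d r : ℕ, 1 ≤ d → 1 ≤ r →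
        bigP D ^ (0.502 : ℝ) < ((d * r : ℕ) : ℝ) →
          ((d * r : ℕ) : ℝ) ≤ bigP D ^ (0.504 : ℝ) / bigT D →
          ‖frakv2 c' χ j d r - 500 * deriv χ.LFunction 1 * PiW χ d r / Real.log (bigP D) *
            (1 + fraky2 c' D j ((d * r : ℕ) : ℝ))‖ ≤
            C * (ell D ^ 15)⁻¹ * (∏ q ∈ (d * r).primeFactors, (1 - (q : ℝ)⁻¹)⁻¹) ^ 2 := by
  obtain ⟨C, D₀, h⟩ := hA
  refine ⟨500 * max C 0, max D₀ 8, fun D _ χ hD hq hp hA' j hj d r hd hr hlo hdr => ?_⟩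
  have hD₀ : D₀ ≤ D := le_trans (le_max_left _ _) hD
  have hlog : 2 ≤ Real.log D := two_le_log_of_eight_le (le_trans (le_max_right _ _) hD)
  have hℓ : 2 ≤ ell D := hlog
  have hP : 0 < bigP D := Real.exp_pos _
  have hP1 : 1 < bigP D := by
    rw [bigP]; exact Real.one_lt_exp_iff.mpr (by rw [ell] at hℓ ⊢; positivity)
  have hy := dr_pos hd hr
  obtain ⟨hT1, hle, hdrP⟩ := range_facts hlog hd hr (a := 0.504) le_rfl hdr
  have key := h D χ hD₀ hq hp hA' j hj d r hd hr hdrP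
  rw [frakv2_eq_logMeans χ c' j hd hr hP1]
  set y : ℝ := ((d * r : ℕ) : ℝ) with hydef
  have e1 := key _ hT1 (hle _ (by norm_num))
  -- the empty means
  have h5 : bigP D ^ (0.5 : ℝ) ≤ bigP D ^ (0.502 : ℝ) :=
    Real.rpow_le_rpow_of_exponent_le hP1.le (by norm_num)
  have hX2 : bigP D ^ (0.502 : ℝ) / y < 1 := by rwa [div_lt_one hy]
  have hX3 : bigP D ^ (0.5 : ℝ) / y < 1 := by rw [div_lt_one hy]; linarith
  have hA2 : ∑ n ∈ Finset.Ioc 0 ⌊bigP D ^ (0.502 : ℝ) / y⌋₊,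
      χ (n : ZMod D) * xiZero c' D j n d r / (n : ℂ) *
        (Real.log (bigP D ^ (0.502 : ℝ) / y / n) : ℂ) = 0 :=
    logMean_eq_zero_of_lt_one _ hX2
  have hA3 : ∑ n ∈ Finset.Ioc 0 ⌊bigP D ^ (0.5 : ℝ) / y⌋₊,
      χ (n : ZMod D) * xiZero c' D j n d r / (n : ℂ) *
        (Real.log (bigP D ^ (0.5 : ℝ) / y / n) : ℂ) = 0 :=
    logMean_eq_zero_of_lt_one _ hX3
  set M : ℂ := deriv χ.LFunction 1 * PiW χ d r with hM
  set βa : ℂ := betaJ c' D (j + 1)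
  set βb : ℂ := betaJ c' D (j + 2)
  set R : ℝ := (∏ q ∈ (d * r).primeFactors, (1 - (q : ℝ)⁻¹)⁻¹) ^ 2 with hR
  set A1 := ∑ n ∈ Finset.Ioc 0 ⌊bigP D ^ (0.504 : ℝ) / y⌋₊,
    χ (n : ZMod D) * xiZero c' D j n d r / (n : ℂ) * (Real.log (bigP D ^ (0.504 : ℝ) / y / n) : ℂ)
  set m1 := M * (1 + (βa + βb) * (Real.log (bigP D ^ (0.504 : ℝ) / y) : ℂ) +
    βa * βb * (Real.log (bigP D ^ (0.504 : ℝ) / y) : ℂ) ^ 2 / 2)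
  have hcomb : m1 = M * (1 + fraky2 c' D j y) := by
    simp only [m1]
    rw [← resComb_one c' D j y]
  have hΛ : (Real.log (bigP D) : ℂ) ≠ 0 := by
    have : 0 < Real.log (bigP D) := Real.log_pos hP1
    exact_mod_cast this.ne'
  rw [hA2, hA3]
  have hv : ((500 / Real.log (bigP D) : ℝ) : ℂ) * (A1 - 2 * 0 + 0) -
      500 * M / Real.log (bigP D) * (1 + fraky2 c' D j y) =
      ((500 / Real.log (bigP D) : ℝ) : ℂ) * (A1 - m1) := by
    have : ((500 / Real.log (bigP D) : ℝ) : ℂ) * (A1 - m1) =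
        ((500 / Real.log (bigP D) : ℝ) : ℂ) * (A1 - 2 * 0 + 0) -
          ((500 / Real.log (bigP D) : ℝ) : ℂ) * m1 := by ring
    rw [this, hcomb]
    push_cast
    field_simp
  rw [show 500 * deriv χ.LFunction 1 * PiW χ d r / (Real.log (bigP D) : ℂ) *
      (1 + fraky2 c' D j y) = 500 * M / Real.log (bigP D) * (1 + fraky2 c' D j y) by
      rw [hM]; ring, hv]
  have hC0 : C * (ell D ^ 6)⁻¹ * R ≤ max C 0 * (ell D ^ 6)⁻¹ * R := by
    have : 0 ≤ (ell D ^ 6)⁻¹ * R := by positivity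
    nlinarith [le_max_left C 0]
  have hE1 : ‖A1 - m1‖ ≤ max C 0 * (ell D ^ 6)⁻¹ * R := e1.trans hC0
  have hlogP : Real.log (bigP D) = ell D ^ 9 := by rw [bigP, Real.log_exp]
  have hℓ0 : 0 < ell D := by linarith
  have hpre : ‖((500 / Real.log (bigP D) : ℝ) : ℂ)‖ = 500 / ell D ^ 9 := by
    rw [Complex.norm_real, Real.norm_of_nonneg (by rw [hlogP]; positivity), hlogP]
  calc ‖((500 / Real.log (bigP D) : ℝ) : ℂ) * (A1 - m1)‖
      = 500 / ell D ^ 9 * ‖A1 - m1‖ := by rw [norm_mul, hpre]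
    _ ≤ 500 / ell D ^ 9 * (max C 0 * (ell D ^ 6)⁻¹ * R) := by gcongr
    _ = 500 * max C 0 * (ell D ^ 15)⁻¹ * R := by field_simp

end Literature.NumberTheory.LFunctions.Zhang2022.Lemma102
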